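import Summits.ABC.StewartYu.PadicG3KStepPhiOdd
import HarnessLib

/-!
# Cell abc-stewartyu, crux `Y07Odd` (stmt-ABC-19658), line `gen3-slab-odd`: the LEVEL INVARIANT with an INTERVAL exponent box (so that the
# Kummer half-step halves the box) and the k-steps on it

`Summits/ABC/StewartYu/PadicG3LevelsI.lean` — cell `abc-stewartyu` (design HOME/p2/HALFSTEP-ODD.md §LEVEL INVARIANT; seat p2-g4, F-odd lead).  One
definition (the `Prop`-valued structure `LvInvI`, refining `PadicG3Levels.LvInv`) and theorems on `G3Setup`; no named fact, no parameters.

`LvInvI S R B v sgn pv lo L P m Xs T` — as `LvInv` but the relative exponents lie in the INTERVAL box `lo_j ≤ vᵢⱼ ≤ lo_j + L_j` containing `0`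
(`lo_j ≤ 0 ≤ lo_j + L_j`): differences of exponents are then bounded by `L_j` (not `2L_j`), which is what makes the next level's box `⌊L_j/2⌋`
(`PadicG3HalfRebase.abs_halfDiff_le`).  `abs_le` recovers `|vᵢⱼ| ≤ L_j` for the Liouville boxes.

* `LvInvI.kstep`, `LvInvI.kstep_odd` — the two k-steps on the invariant (`g3_kstep_pm`, `g3_kstep_pm_oddNodes`), `T′ + t ≤ T`.

WHAT THIS IS NOT: the half-step on the invariant (`PadicG3LevelStepH`), the Siegel start and the output; no crux moves.

References: Yu. V. Nesterenko, LNM 1819 (2003) Prop. 4.1 (the induction on `(s, ν)`); K. Yu, Acta Math. 211 (2013) §5.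
-/

noncomputable section

open NormedSpace Finset Polynomial
open Literature.NumberTheory.Transcendental
open Literature.NumberTheory.Transcendental.PadicCW77 (condExp)
open Literature.NumberTheory.Transcendental.CW77.Setup (Tau tauNorm)
open scoped Nat

namespace Summit.ABC.StewartYu

namespace G3Setup

variable {p : ℕ} [Fact p.Prime] (S : G3Setup p) {ι : Type*}

/-- **The level invariant with an interval box** (state of Nesterenko's induction for the generic class family).
[cite: Nesterenko2003, Prop 4.1; shape only] -/
structure LvInvI (R : ι → ℚ[X]) (B : Finset ι) (v : ι → Fin S.n → ℤ) (sgn pv : ι → ℤ) (lo : Fin S.n → ℤ) (L : Fin S.n → ℕ) (P : ℤ)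
    (m : ℕ) (Xs : Set ℤ) (T : ℕ) : Prop where
  /-- some coefficient is non-zero -/
  nonzero : ∃ i ∈ B, pv i ≠ 0
  /-- the coefficients are bounded -/
  bound : ∀ i ∈ B, |pv i| ≤ P
  /-- the interval box contains `0` -/
  lo_le : ∀ j, lo j ≤ 0 ∧ 0 ≤ lo j + L j
  /-- the exponents lie in the interval box -/
  box : ∀ i ∈ B, ∀ j, lo j ≤ v i j ∧ v i j ≤ lo j + L j
  /-- the signs are `±1` -/
  sgn_pm : ∀ i, sgn i = 1 ∨ sgn i = -1
  /-- two sign classes -/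
  cls : ∀ i ∈ B, S.cls (v i) = (sgn i : ℚ_[p])
  /-- slab depth of the exponents -/
  depth : ∀ i ∈ B, ‖S.E (v i)‖ ≤ (p : ℝ)⁻¹ ^ (m + 1)
  /-- slab depth of the differences -/
  slab : ∀ i ∈ B, ∀ i' ∈ B, ‖S.Lsum (v i) - S.Lsum (v i')‖ ≤ (p : ℝ)⁻¹ ^ (m + 1)
  /-- the vanishing at the nodes, with sign-twisted coefficients -/
  vanish : ∀ x ∈ Xs, ∀ τ : Tau S.n, tauNorm τ < T → S.g3φ R v B (pvx sgn pv x) τ x = 0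

namespace LvInvI

variable {S} {R : ι → ℚ[X]} {B : Finset ι} {v : ι → Fin S.n → ℤ} {sgn pv : ι → ℤ} {lo : Fin S.n → ℤ} {L : Fin S.n → ℕ} {P : ℤ}
  {m : ℕ} {Xs : Set ℤ} {T : ℕ}

/-- Changing the node set and the order by an implication. [folklore] -/
theorem mono (h : S.LvInvI R B v sgn pv lo L P m Xs T) {Xs' : Set ℤ} {T' : ℕ} (hX : Xs' ⊆ Xs) (hT : T' ≤ T) :
    S.LvInvI R B v sgn pv lo L P m Xs' T' :=
  ⟨h.nonzero, h.bound, h.lo_le, h.box, h.sgn_pm, h.cls, h.depth, h.slab,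
    fun x hx τ hτ => h.vanish x (hX hx) τ (lt_of_lt_of_le hτ hT)⟩

/-- The absolute box: `|vᵢⱼ| ≤ L_j`. [folklore] -/
theorem abs_le (h : S.LvInvI R B v sgn pv lo L P m Xs T) : ∀ i ∈ B, ∀ j, |v i j| ≤ (L j : ℤ) := by
  intro i hi j
  have h1 := h.box i hi j
  have h2 := h.lo_le j
  rw [_root_.abs_le]; constructor <;> omega

/-- Differences of exponents are bounded by `L_j`. [folklore] -/
theorem abs_sub_le (h : S.LvInvI R B v sgn pv lo L P m Xs T) : ∀ i ∈ B, ∀ i' ∈ B, ∀ j, |v i j - v i' j| ≤ (L j : ℤ) := by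
  intro i hi i' hi' j
  have h1 := h.box i hi j
  have h2 := h.box i' hi' j
  rw [_root_.abs_le]; constructor <;> omega

/-- **The k-step on the invariant** (symmetric nodes `|x| ≤ N` → `|x| ≤ N′`, orders `T → T′` with `T′ + t ≤ T`), under the record's
`Y₀`-weight bound `Bw` at radius `p^m√p`, pointwise Liouville datum `(den₀, M₀, Xb, K)` and the numerical inequality `hfinal`.
[cite: Nesterenko2003, §4.2] [cite: Yu2013, Lemma 5.2] -/
theorem kstep {N : ℕ} (h : S.LvInvI R B v sgn pv lo L P m {x : ℤ | |x| ≤ (N : ℤ)} T) {N' T' t : ℕ} (ht : 1 ≤ t) (hT : T' + t ≤ T)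
    {Bw : ℝ} (hBw0 : 0 ≤ Bw) (hBw : ∀ i ∈ B, ∀ t₀ k, ‖(hw (p := p) R i t₀).coeff k‖ * ((p : ℝ) ^ m * Real.sqrt p) ^ k ≤ Bw)
    (hΛ : ‖S.Λ / (S.b S.j₀ : ℚ_[p])‖ ≤ (p : ℝ)⁻¹)
    (den₀ : ℤ → Tau S.n → ℕ) (hden₀ : ∀ x τ, 1 ≤ den₀ x τ) (M₀ : ℤ → Tau S.n → ℤ)
    (hR : ∀ (x : ℤ) (τ : Tau S.n), ∀ i ∈ B, ∃ z₀ : ℤ, (den₀ x τ : ℚ) * (hasseDeriv τ.1 (R i)).eval (x : ℚ) = z₀ ∧ |z₀| ≤ M₀ x τ)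
    {Xb : ℤ} (hX : ∀ i ∈ B, ∀ k, |S.𝔛 (v i) k| ≤ Xb)
    (K : ℤ → Tau S.n → ℝ) (hK0 : ∀ x τ, 0 < K x τ)
    (hK : ∀ (x : ℤ) (τ : Tau S.n), (B.card : ℝ) * P * (M₀ x τ * (Xb : ℝ) ^ (∑ k, τ.2 k) *
      ((MonomialDen.monDen S.α (S.boxExpG L x) : ℝ)) ^ 2) ≤ K x τ)
    (hfinal : ∀ x₁ : ℤ, |x₁| ≤ (N' : ℤ) → ∀ τ : Tau S.n, tauNorm τ + t ≤ T →
      max (Bw * ‖S.Λ / (S.b S.j₀ : ℚ_[p])‖ * (p : ℝ) ^ ((t - 1) / 2) * (p : ℝ) ^ condExp p (2 * N + 1) t)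
        (Bw / ((p : ℝ) ^ m * Real.sqrt p) ^ ((2 * N + 1) * t)) < 1 / K x₁ τ) :
    S.LvInvI R B v sgn pv lo L P m {x : ℤ | |x| ≤ (N' : ℤ)} T' := by
  refine ⟨h.nonzero, h.bound, h.lo_le, h.box, h.sgn_pm, h.cls, h.depth, h.slab, fun x₁ hx₁ τ hτ => ?_⟩
  have hk := S.g3_kstep_pm R v m B h.depth sgn h.sgn_pm h.cls pv ht hBw0 hBw hΛ
    (fun x hx τ'' hτ'' => h.vanish x hx τ'' hτ'') h.abs_le den₀ hden₀ M₀ hR hX h.bound K hK0 hK hfinal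
  exact hk x₁ hx₁ τ (by omega)

/-- **The first k-step of a level** (odd nodes `|x| ≤ 2N − 1` → all `|x| ≤ N′`). [cite: Nesterenko2003, §4.2 with 𝒳_{s,0}] -/
theorem kstep_odd {N : ℕ} (h : S.LvInvI R B v sgn pv lo L P m {x : ℤ | Odd x ∧ |x| ≤ (2 * N - 1 : ℤ)} T) {N' T' t : ℕ} (ht : 1 ≤ t)
    (hT : T' + t ≤ T)
    {Bw : ℝ} (hBw0 : 0 ≤ Bw) (hBw : ∀ i ∈ B, ∀ t₀ k, ‖(hw (p := p) R i t₀).coeff k‖ * ((p : ℝ) ^ m * Real.sqrt p) ^ k ≤ Bw)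
    (hΛ : ‖S.Λ / (S.b S.j₀ : ℚ_[p])‖ ≤ (p : ℝ)⁻¹)
    (den₀ : ℤ → Tau S.n → ℕ) (hden₀ : ∀ x τ, 1 ≤ den₀ x τ) (M₀ : ℤ → Tau S.n → ℤ)
    (hR : ∀ (x : ℤ) (τ : Tau S.n), ∀ i ∈ B, ∃ z₀ : ℤ, (den₀ x τ : ℚ) * (hasseDeriv τ.1 (R i)).eval (x : ℚ) = z₀ ∧ |z₀| ≤ M₀ x τ)
    {Xb : ℤ} (hX : ∀ i ∈ B, ∀ k, |S.𝔛 (v i) k| ≤ Xb)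
    (K : ℤ → Tau S.n → ℝ) (hK0 : ∀ x τ, 0 < K x τ)
    (hK : ∀ (x : ℤ) (τ : Tau S.n), (B.card : ℝ) * P * (M₀ x τ * (Xb : ℝ) ^ (∑ k, τ.2 k) *
      ((MonomialDen.monDen S.α (S.boxExpG L x) : ℝ)) ^ 2) ≤ K x τ)
    (hfinal : ∀ x₁ : ℤ, |x₁| ≤ (N' : ℤ) → ∀ τ : Tau S.n, tauNorm τ + t ≤ T →
      max (Bw * ‖S.Λ / (S.b S.j₀ : ℚ_[p])‖ * (p : ℝ) ^ ((t - 1) / 2) * (p : ℝ) ^ condExp p (2 * N) t)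
        (Bw / ((p : ℝ) ^ m * Real.sqrt p) ^ ((2 * N) * t)) < 1 / K x₁ τ) :
    S.LvInvI R B v sgn pv lo L P m {x : ℤ | |x| ≤ (N' : ℤ)} T' := by
  refine ⟨h.nonzero, h.bound, h.lo_le, h.box, h.sgn_pm, h.cls, h.depth, h.slab, fun x₁ hx₁ τ hτ => ?_⟩
  have hk := S.g3_kstep_pm_oddNodes R v m B h.depth sgn h.sgn_pm h.cls pv ht hBw0 hBw hΛ
    (fun x hx hx' τ'' hτ'' => h.vanish x ⟨hx, hx'⟩ τ'' hτ'') h.abs_le den₀ hden₀ M₀ hR hX h.bound K hK0 hK hfinal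
  exact hk x₁ hx₁ τ (by omega)

end LvInvI

end G3Setup

end Summit.ABC.StewartYu

end
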